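import Summits.Parity.GeneralizedHardyLittlewood.Theorems.PrimeLevelFamEdgeMomentsBeyondDiagonalDiagRemTwoTwoBoseB
import HarnessLib

/-!
# Route `PrimeLevelFamEdge`, crux K_A `MomentsBeyondDiagonal` (stmt-Parity-20007), line «petersson_layers» v4, stub `stub_diag`:
# **the continued Bose remainders `r₀₀, r₀₁, r₀₂, r₁₀, r₁₁` in `Π`-form with EXPLICIT `μ₂` — two-sequence Abel estimate** (brick B2a of (R₂₂))

Part of brick B2 of the order-`(2,2)` remainder estimate (plan: `Cruxes/MomentsBeyondDiagonal/Lines/petersson_layers_stub_diag_g12_R02_R22.md`):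
the companion of `…DiagRemTwoTwoBoseB.abs_doubleSum_rem_le₂₂b`: the five orders `(a,b)` with `a ≤ 1`, `b ≤ 2`, `(a,b) ≠ (1,2)`,
in `Π`-form with the moment `μ₂ = ∫₀¹log²v·v/(1+v²)²` EXPLICIT and the SAME envelope `9C₀(1+|log 2αY²|)⁶`, so that the nine
remainders of the order-`(2,2)` weight have literally shared `μ₂, μ₄` (the tree's `…DiagRemBoseTwoSeq.abs_doubleSum_rem_le₂` /
`…DiagRemZeroTwoBose.abs_doubleSum_rem_le₀₂` hide `μ₂` behind an existential): `Π₀₀ = L/2 + E₀₀`, `Π₀₁ = Π₁₀-shape = −L²/8 + E`,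
`Π₀₂ = L³/24 + 2μ₂L + E₀₂`, `Π₁₁ = L³/24 − 2μ₂L + E₁₁`.

* `abs_doubleSum_rem_le₂₂a` — **the five estimates with common constants `E₀₀, E₀₁, E₀₂, E₁₀, E₁₁, C₀`.**

Def-free; theorems only. Helper `--supports stmt-Parity-20007`; closes nothing; K_A, K_B and the Parity summit are NOT proved;
nothing about Landau–Siegel zeros.

## References
* E. Kowalski, P. Michel, J. VanderKam, J. reine angew. Math. 526 (2000), (22)–(28) pp. 12–15 and Prop. 5.1 p. 18.
  [cite: KowalskiMichelVanderKam2000, Prop. 5.1 — derivation (corner of the diagonal, general Q, remainder weights, order (2,2))]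
-/

noncomputable section

open Real MeasureTheory Finset

namespace Summit.Parity.GeneralizedHardyLittlewood.Theorems.MomentsBeyondDiagonal.DiagCorner

open Summit.Parity.GeneralizedHardyLittlewood.Theorems.BeyondDiagonalBeatsQuarter.Corner
open Summit.Parity.GeneralizedHardyLittlewood.Theorems.MomentsBeyondDiagonal.DiagLines

/-- **THE CONTINUED BOSE REMAINDERS `r₀₀, r₀₁, r₀₂, r₁₀, r₁₁` IN `Π`-FORM (moment `μ₂` explicit), TWO-SEQUENCE ABEL ESTIMATE WITH
THE COMMON ENVELOPE OF `…DiagRemTwoTwoBoseB`.** [cite: KowalskiMichelVanderKam2000, (22)–(28) and Prop. 5.1 — derivation (corner of the diagonal, general Q, order (2,2))] -/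
theorem abs_doubleSum_rem_le₂₂a : ∃ E₀₀ E₀₁ E₀₂ E₁₀ E₁₁ C₀ : ℝ, 0 ≤ C₀ ∧
    ∀ (a₁ a₂ : ℕ → ℝ) (Y α B η : ℝ) (K₁ i j : ℕ), 1 ≤ Y → 0 < α → 1 ≤ i → 1 ≤ j →
      (∀ e : ℕ, e ≤ ⌊Y⌋₊ → |∑ k ∈ Icc 1 e, a₂ k| ≤ B) → (∀ e : ℕ, K₁ ≤ e → |∑ k ∈ Icc 1 e, a₁ k| ≤ η) →
      2 * α * K₁ * Y ≤ 1 →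
    |∑ k₁ ∈ Icc 1 ⌊Y⌋₊, ∑ k₂ ∈ Icc 1 ⌊Y⌋₊,
        a₁ k₁ * a₂ k₂ * ellp Y k₁ ^ i * ellp Y k₂ ^ j *
          ((∫ u₁ in Set.Ioi (0 : ℝ), ∫ u₂ in Set.Ioi ((α * k₁ * k₂) / u₁),
              Real.exp (-(u₁ + u₂)) / (1 - Real.exp (-(u₁ + u₂))) ^ 2) -
            (Real.log (1 / (α * k₁ * k₂)) / 2 + E₀₀))| ≤
      (∑ k ∈ Icc 1 ⌊Y⌋₊, |a₁ k| * ellp Y k ^ i) * (B * (Real.log Y ^ j * (3 * C₀ * Real.sqrt (2 * α * K₁ * Y)))) +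
        (∑ k ∈ Icc 1 ⌊Y⌋₊, |a₂ k| * ellp Y k ^ j) *
          ((2 * η) * (Real.log Y ^ i * (9 * C₀ * (1 + |Real.log (2 * α * Y ^ 2)|) ^ 6))) ∧
    |∑ k₁ ∈ Icc 1 ⌊Y⌋₊, ∑ k₂ ∈ Icc 1 ⌊Y⌋₊,
        a₁ k₁ * a₂ k₂ * ellp Y k₁ ^ i * ellp Y k₂ ^ j *
          ((∫ u₁ in Set.Ioi (0 : ℝ), ∫ u₂ in Set.Ioi ((α * k₁ * k₂) / u₁),
              Real.exp (-(u₁ + u₂)) / (1 - Real.exp (-(u₁ + u₂))) ^ 2 * Real.log u₂) -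
            (-(Real.log (1 / (α * k₁ * k₂)) ^ 2) / 8 + E₀₁))| ≤
      (∑ k ∈ Icc 1 ⌊Y⌋₊, |a₁ k| * ellp Y k ^ i) * (B * (Real.log Y ^ j * (3 * C₀ * Real.sqrt (2 * α * K₁ * Y)))) +
        (∑ k ∈ Icc 1 ⌊Y⌋₊, |a₂ k| * ellp Y k ^ j) *
          ((2 * η) * (Real.log Y ^ i * (9 * C₀ * (1 + |Real.log (2 * α * Y ^ 2)|) ^ 6))) ∧
    |∑ k₁ ∈ Icc 1 ⌊Y⌋₊, ∑ k₂ ∈ Icc 1 ⌊Y⌋₊,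
        a₁ k₁ * a₂ k₂ * ellp Y k₁ ^ i * ellp Y k₂ ^ j *
          ((∫ u₁ in Set.Ioi (0 : ℝ), ∫ u₂ in Set.Ioi ((α * k₁ * k₂) / u₁),
              Real.exp (-(u₁ + u₂)) / (1 - Real.exp (-(u₁ + u₂))) ^ 2 * Real.log u₂ ^ 2) -
            (Real.log (1 / (α * k₁ * k₂)) ^ 3 / 24 + 2 * (∫ v in Set.Ioc (0 : ℝ) 1, Real.log v ^ 2 * (v / (1 + v ^ 2) ^ 2)) * Real.log (1 / (α * k₁ * k₂)) + E₀₂))| ≤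
      (∑ k ∈ Icc 1 ⌊Y⌋₊, |a₁ k| * ellp Y k ^ i) * (B * (Real.log Y ^ j * (3 * C₀ * Real.sqrt (2 * α * K₁ * Y)))) +
        (∑ k ∈ Icc 1 ⌊Y⌋₊, |a₂ k| * ellp Y k ^ j) *
          ((2 * η) * (Real.log Y ^ i * (9 * C₀ * (1 + |Real.log (2 * α * Y ^ 2)|) ^ 6))) ∧
    |∑ k₁ ∈ Icc 1 ⌊Y⌋₊, ∑ k₂ ∈ Icc 1 ⌊Y⌋₊,
        a₁ k₁ * a₂ k₂ * ellp Y k₁ ^ i * ellp Y k₂ ^ j *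
          ((∫ u₁ in Set.Ioi (0 : ℝ), Real.log u₁ * ∫ u₂ in Set.Ioi ((α * k₁ * k₂) / u₁),
              Real.exp (-(u₁ + u₂)) / (1 - Real.exp (-(u₁ + u₂))) ^ 2) -
            (-(Real.log (1 / (α * k₁ * k₂)) ^ 2) / 8 + E₁₀))| ≤
      (∑ k ∈ Icc 1 ⌊Y⌋₊, |a₁ k| * ellp Y k ^ i) * (B * (Real.log Y ^ j * (3 * C₀ * Real.sqrt (2 * α * K₁ * Y)))) +
        (∑ k ∈ Icc 1 ⌊Y⌋₊, |a₂ k| * ellp Y k ^ j) *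
          ((2 * η) * (Real.log Y ^ i * (9 * C₀ * (1 + |Real.log (2 * α * Y ^ 2)|) ^ 6))) ∧
    |∑ k₁ ∈ Icc 1 ⌊Y⌋₊, ∑ k₂ ∈ Icc 1 ⌊Y⌋₊,
        a₁ k₁ * a₂ k₂ * ellp Y k₁ ^ i * ellp Y k₂ ^ j *
          ((∫ u₁ in Set.Ioi (0 : ℝ), Real.log u₁ * ∫ u₂ in Set.Ioi ((α * k₁ * k₂) / u₁),
              Real.exp (-(u₁ + u₂)) / (1 - Real.exp (-(u₁ + u₂))) ^ 2 * Real.log u₂) -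
            (Real.log (1 / (α * k₁ * k₂)) ^ 3 / 24 - 2 * (∫ v in Set.Ioc (0 : ℝ) 1, Real.log v ^ 2 * (v / (1 + v ^ 2) ^ 2)) * Real.log (1 / (α * k₁ * k₂)) + E₁₁))| ≤
      (∑ k ∈ Icc 1 ⌊Y⌋₊, |a₁ k| * ellp Y k ^ i) * (B * (Real.log Y ^ j * (3 * C₀ * Real.sqrt (2 * α * K₁ * Y)))) +
        (∑ k ∈ Icc 1 ⌊Y⌋₊, |a₂ k| * ellp Y k ^ j) *
          ((2 * η) * (Real.log Y ^ i * (9 * C₀ * (1 + |Real.log (2 * α * Y ^ 2)|) ^ 6))) := by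
  obtain ⟨C₀₀, hC₀₀, h₀₀⟩ := abs_doubleSum_bose_rem_le₂ 0 0
  obtain ⟨C₀₁, hC₀₁, h₀₁⟩ := abs_doubleSum_bose_rem_le₂ 0 1
  obtain ⟨C₀₂, hC₀₂, h₀₂⟩ := abs_doubleSum_bose_rem_le₂ 0 2
  obtain ⟨C₁₀, hC₁₀, h₁₀⟩ := abs_doubleSum_bose_rem_le₂ 1 0
  obtain ⟨C₁₁, hC₁₁, h₁₁⟩ := abs_doubleSum_bose_rem_le₂ 1 1
  set C₀ : ℝ := max (max (max C₀₀ C₀₁) (max C₀₂ C₁₀)) C₁₁ with hC₀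
  have e₀₀ : C₀₀ ≤ C₀ := ((le_max_left _ _).trans (le_max_left _ _)).trans (le_max_left _ _)
  have e₀₁ : C₀₁ ≤ C₀ := ((le_max_right _ _).trans (le_max_left _ _)).trans (le_max_left _ _)
  have e₀₂ : C₀₂ ≤ C₀ := ((le_max_left _ _).trans (le_max_right _ _)).trans (le_max_left _ _)
  have e₁₀ : C₁₀ ≤ C₀ := ((le_max_right _ _).trans (le_max_right _ _)).trans (le_max_left _ _)
  have e₁₁ : C₁₁ ≤ C₀ := le_max_right _ _
  have hC₀0 : 0 ≤ C₀ := hC₀₀.trans e₀₀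
  refine ⟨(∫ u₁ in Set.Ioi (0 : ℝ), Real.log u₁ ^ 0 * ∫ u₂ in Set.Ioi (1 / u₁),
        Real.exp (-(u₁ + u₂)) / (1 - Real.exp (-(u₁ + u₂))) ^ 2 * Real.log u₂ ^ 0) +
      (∫ η in Set.Ioc (0 : ℝ) 1, (η * (∫ u in Set.Ioi (0 : ℝ), Real.log u ^ 0 * Real.log (η / u) ^ 0 *
            (Real.exp (-(u + η / u)) / (1 - Real.exp (-(u + η / u))) ^ 2) / u) -
          ∫ v in Set.Ioc (0 : ℝ) 1, ((-(Real.log (1 / η) / 2) + Real.log v) ^ 0 * (-(Real.log (1 / η) / 2) - Real.log v) ^ 0 +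
              (-(Real.log (1 / η) / 2) - Real.log v) ^ 0 * (-(Real.log (1 / η) / 2) + Real.log v) ^ 0) *
            (v / (1 + v ^ 2) ^ 2)) / η),
    (∫ u₁ in Set.Ioi (0 : ℝ), Real.log u₁ ^ 0 * ∫ u₂ in Set.Ioi (1 / u₁),
        Real.exp (-(u₁ + u₂)) / (1 - Real.exp (-(u₁ + u₂))) ^ 2 * Real.log u₂ ^ 1) +
      (∫ η in Set.Ioc (0 : ℝ) 1, (η * (∫ u in Set.Ioi (0 : ℝ), Real.log u ^ 0 * Real.log (η / u) ^ 1 *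
            (Real.exp (-(u + η / u)) / (1 - Real.exp (-(u + η / u))) ^ 2) / u) -
          ∫ v in Set.Ioc (0 : ℝ) 1, ((-(Real.log (1 / η) / 2) + Real.log v) ^ 0 * (-(Real.log (1 / η) / 2) - Real.log v) ^ 1 +
              (-(Real.log (1 / η) / 2) - Real.log v) ^ 0 * (-(Real.log (1 / η) / 2) + Real.log v) ^ 1) *
            (v / (1 + v ^ 2) ^ 2)) / η),
    (∫ u₁ in Set.Ioi (0 : ℝ), Real.log u₁ ^ 0 * ∫ u₂ in Set.Ioi (1 / u₁),
        Real.exp (-(u₁ + u₂)) / (1 - Real.exp (-(u₁ + u₂))) ^ 2 * Real.log u₂ ^ 2) +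
      (∫ η in Set.Ioc (0 : ℝ) 1, (η * (∫ u in Set.Ioi (0 : ℝ), Real.log u ^ 0 * Real.log (η / u) ^ 2 *
            (Real.exp (-(u + η / u)) / (1 - Real.exp (-(u + η / u))) ^ 2) / u) -
          ∫ v in Set.Ioc (0 : ℝ) 1, ((-(Real.log (1 / η) / 2) + Real.log v) ^ 0 * (-(Real.log (1 / η) / 2) - Real.log v) ^ 2 +
              (-(Real.log (1 / η) / 2) - Real.log v) ^ 0 * (-(Real.log (1 / η) / 2) + Real.log v) ^ 2) *
            (v / (1 + v ^ 2) ^ 2)) / η),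
    (∫ u₁ in Set.Ioi (0 : ℝ), Real.log u₁ ^ 1 * ∫ u₂ in Set.Ioi (1 / u₁),
        Real.exp (-(u₁ + u₂)) / (1 - Real.exp (-(u₁ + u₂))) ^ 2 * Real.log u₂ ^ 0) +
      (∫ η in Set.Ioc (0 : ℝ) 1, (η * (∫ u in Set.Ioi (0 : ℝ), Real.log u ^ 1 * Real.log (η / u) ^ 0 *
            (Real.exp (-(u + η / u)) / (1 - Real.exp (-(u + η / u))) ^ 2) / u) -
          ∫ v in Set.Ioc (0 : ℝ) 1, ((-(Real.log (1 / η) / 2) + Real.log v) ^ 1 * (-(Real.log (1 / η) / 2) - Real.log v) ^ 0 +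
              (-(Real.log (1 / η) / 2) - Real.log v) ^ 1 * (-(Real.log (1 / η) / 2) + Real.log v) ^ 0) *
            (v / (1 + v ^ 2) ^ 2)) / η),
    (∫ u₁ in Set.Ioi (0 : ℝ), Real.log u₁ ^ 1 * ∫ u₂ in Set.Ioi (1 / u₁),
        Real.exp (-(u₁ + u₂)) / (1 - Real.exp (-(u₁ + u₂))) ^ 2 * Real.log u₂ ^ 1) +
      (∫ η in Set.Ioc (0 : ℝ) 1, (η * (∫ u in Set.Ioi (0 : ℝ), Real.log u ^ 1 * Real.log (η / u) ^ 1 *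
            (Real.exp (-(u + η / u)) / (1 - Real.exp (-(u + η / u))) ^ 2) / u) -
          ∫ v in Set.Ioc (0 : ℝ) 1, ((-(Real.log (1 / η) / 2) + Real.log v) ^ 1 * (-(Real.log (1 / η) / 2) - Real.log v) ^ 1 +
              (-(Real.log (1 / η) / 2) - Real.log v) ^ 1 * (-(Real.log (1 / η) / 2) + Real.log v) ^ 1) *
            (v / (1 + v ^ 2) ^ 2)) / η),
    C₀, hC₀0, fun a₁ a₂ Y α B η K₁ i j hY hα hi hj hB hη hY₁ ↦ ?_⟩
  have hY0 : 0 < Y := by linarith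
  have hη0 : 0 ≤ η := (abs_nonneg _).trans (hη K₁ le_rfl)
  have hLY : 0 ≤ Real.log Y := Real.log_nonneg hY
  have hx : (1 : ℝ) ≤ 1 + |Real.log (2 * α * Y ^ 2)| := by linarith [abs_nonneg (Real.log (2 * α * Y ^ 2))]
  have hSj : 0 ≤ ∑ k ∈ Icc 1 ⌊Y⌋₊, |a₂ k| * ellp Y k ^ j :=
    Finset.sum_nonneg fun k _ ↦ mul_nonneg (abs_nonneg _) (pow_nonneg (ellp_nonneg Y k) j)
  have hSi : 0 ≤ ∑ k ∈ Icc 1 ⌊Y⌋₊, |a₁ k| * ellp Y k ^ i :=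
    Finset.sum_nonneg fun k _ ↦ mul_nonneg (abs_nonneg _) (pow_nonneg (ellp_nonneg Y k) i)
  have hB0 : 0 ≤ B := (abs_nonneg _).trans (hB 0 (Nat.zero_le _))
  have hsq : 0 ≤ Real.sqrt (2 * α * K₁ * Y) := Real.sqrt_nonneg _
  have hfirst : ∀ {C : ℝ}, C ≤ C₀ →
      (∑ k ∈ Icc 1 ⌊Y⌋₊, |a₁ k| * ellp Y k ^ i) * (B * (Real.log Y ^ j * (3 * C * Real.sqrt (2 * α * K₁ * Y)))) ≤
      (∑ k ∈ Icc 1 ⌊Y⌋₊, |a₁ k| * ellp Y k ^ i) * (B * (Real.log Y ^ j * (3 * C₀ * Real.sqrt (2 * α * K₁ * Y)))) := by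
    intro C hC
    have hLj : 0 ≤ Real.log Y ^ j := pow_nonneg hLY j
    gcongr
  have hsecond : ∀ {C : ℝ} {N : ℕ}, 0 ≤ C → C ≤ C₀ →
      (∑ k ∈ Icc 1 ⌊Y⌋₊, |a₂ k| * ellp Y k ^ j) * ((2 * η) * (Real.log Y ^ i *
          (3 * (C + C * (1 + |Real.log (2 * α * Y ^ 2)|) ^ N) + 2 * C +
            C * (1 + |Real.log (2 * α * Y ^ 2)|) ^ N * (1 + |Real.log (2 * α * Y ^ 2)|)))) ≤
      (∑ k ∈ Icc 1 ⌊Y⌋₊, |a₂ k| * ellp Y k ^ j) * ((2 * η) * (Real.log Y ^ i *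
          (3 * (C₀ + C₀ * (1 + |Real.log (2 * α * Y ^ 2)|) ^ N) + 2 * C₀ +
            C₀ * (1 + |Real.log (2 * α * Y ^ 2)|) ^ N * (1 + |Real.log (2 * α * Y ^ 2)|)))) := by
    intro C N hC hCC
    have hLi : 0 ≤ Real.log Y ^ i := pow_nonneg hLY i
    have hxN : 0 ≤ (1 + |Real.log (2 * α * Y ^ 2)|) ^ N := pow_nonneg (by positivity) N
    gcongr
  refine ⟨?_, ?_, ?_, ?_, ?_⟩
  · have h := h₀₀ a₁ a₂ Y α B η K₁ i j hY hα hi hj hB hη hY₁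
    have h' := le_trans h (add_le_add (hfirst e₀₀) (hsecond hC₀₀ e₀₀))
    have h'' := weaken_second_term6 hSj hη0 hLY hC₀0 hx (by norm_num : 0 + 0 + 1 ≤ 5) h'
    refine le_trans (le_of_eq ?_) h''
    congr 1
    refine Finset.sum_congr rfl fun k₁ _ ↦ Finset.sum_congr rfl fun k₂ _ ↦ ?_
    simp only [Finset.sum_range_succ, Finset.sum_range_zero, zero_add, add_zero, Nat.choose_self,
      Nat.cast_one, Nat.sub_self, Nat.cast_zero, Nat.cast_add, pow_zero, pow_one,
      one_mul, mul_one, integral_model_weight_Ioc]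
    ring
  · have h := h₀₁ a₁ a₂ Y α B η K₁ i j hY hα hi hj hB hη hY₁
    have h' := le_trans h (add_le_add (hfirst e₀₁) (hsecond hC₀₁ e₀₁))
    have h'' := weaken_second_term6 hSj hη0 hLY hC₀0 hx (by norm_num : 0 + 1 + 1 ≤ 5) h'
    refine le_trans (le_of_eq ?_) h''
    congr 1
    refine Finset.sum_congr rfl fun k₁ _ ↦ Finset.sum_congr rfl fun k₂ _ ↦ ?_
    simp only [Finset.sum_range_succ, Finset.sum_range_zero, zero_add, add_zero, Nat.choose_self,
      Nat.choose_zero_right, Nat.cast_one, Nat.sub_self, Nat.sub_zero, Nat.reduceAdd, Nat.cast_zero, Nat.cast_add,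
      pow_zero, pow_one, one_mul, mul_one, integral_model_weight_Ioc]
    ring
  · have h := h₀₂ a₁ a₂ Y α B η K₁ i j hY hα hi hj hB hη hY₁
    have h' := le_trans h (add_le_add (hfirst e₀₂) (hsecond hC₀₂ e₀₂))
    have h'' := weaken_second_term6 hSj hη0 hLY hC₀0 hx (by norm_num : 0 + 2 + 1 ≤ 5) h'
    refine le_trans (le_of_eq ?_) h''
    congr 1
    refine Finset.sum_congr rfl fun k₁ _ ↦ Finset.sum_congr rfl fun k₂ _ ↦ ?_
    simp only [Finset.sum_range_succ, Finset.sum_range_zero, zero_add, add_zero, Nat.choose_self,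
      Nat.choose_zero_right, Nat.choose_one_right, Nat.cast_one, Nat.cast_ofNat, Nat.sub_self, Nat.sub_zero,
      Nat.reduceSub, Nat.reduceAdd, Nat.cast_zero, Nat.cast_add, pow_zero, pow_one, one_mul, mul_one,
      integral_model_weight_Ioc]
    ring
  · have h := h₁₀ a₁ a₂ Y α B η K₁ i j hY hα hi hj hB hη hY₁
    have h' := le_trans h (add_le_add (hfirst e₁₀) (hsecond hC₁₀ e₁₀))
    have h'' := weaken_second_term6 hSj hη0 hLY hC₀0 hx (by norm_num : 1 + 0 + 1 ≤ 5) h'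
    refine le_trans (le_of_eq ?_) h''
    congr 1
    refine Finset.sum_congr rfl fun k₁ _ ↦ Finset.sum_congr rfl fun k₂ _ ↦ ?_
    simp only [Finset.sum_range_succ, Finset.sum_range_zero, zero_add, add_zero, Nat.choose_self,
      Nat.choose_zero_right, Nat.cast_one, Nat.sub_self, Nat.sub_zero, Nat.reduceAdd, Nat.cast_zero, Nat.cast_add,
      pow_zero, pow_one, one_mul, mul_one, integral_model_weight_Ioc]
    ring
  · have h := h₁₁ a₁ a₂ Y α B η K₁ i j hY hα hi hj hB hη hY₁
    have h' := le_trans h (add_le_add (hfirst e₁₁) (hsecond hC₁₁ e₁₁))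
    have h'' := weaken_second_term6 hSj hη0 hLY hC₀0 hx (by norm_num : 1 + 1 + 1 ≤ 5) h'
    refine le_trans (le_of_eq ?_) h''
    congr 1
    refine Finset.sum_congr rfl fun k₁ _ ↦ Finset.sum_congr rfl fun k₂ _ ↦ ?_
    simp only [Finset.sum_range_succ, Finset.sum_range_zero, zero_add, add_zero, Nat.choose_self,
      Nat.choose_zero_right, Nat.cast_one, Nat.sub_self, Nat.sub_zero, Nat.reduceAdd, Nat.cast_zero, Nat.cast_add,
      pow_zero, pow_one, one_mul, mul_one, integral_model_weight_Ioc]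
    ring

end Summit.Parity.GeneralizedHardyLittlewood.Theorems.MomentsBeyondDiagonal.DiagCorner

end
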